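import Summits.QuantumFields.BalabanUV.Beta.GAN24.DirichletExhaustionLimit
import Summits.QuantumFields.BalabanUV.Beta.GAN24.DirichletExhaustionCoer
import Summits.QuantumFields.BalabanUV.Beta.GAN24.EffectiveLaplacianLimit

/-!
# `BalabanUV.Beta.GAN24.DirichletExhaustionPerfectCovariance` — binder row G-an2-4 ∕ (CONV-C), part P2, PART 24: BAŁABAN's PERFECT `U = 1`
# COVARIANCE `C^{(∞)}(𝟙)` ON EVERY DIRICHLET REGION OF `ℤ^{d+1}` NAMED, with `C^{(k)}_Λ → C^{(∞)}_Λ` at rate `L^{−2k}` and constants explicit in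
# `(d, L)` — the `k = ∞` companion of road P2's T `DirichletExhaustionCoer.convC_balaban` (unit b2b-balaban-gan24-p2, gen 16, v1)

NOT IN PRINT; OUR CONSTRUCTION.  HONEST FRAMING (cell contract, verbatim): «discharging `BetaPertH` makes Bałaban's UV stability UNCONDITIONAL — a
real constructive-QFT result; it is NOT the continuum limit and NOT the Clay problem.»  HONEST DEPENDENCY (verbatim): «continuum YM on T⁴ ⇐ BetaPertH ∧
nine spine estimates (0/9 proved); BetaPertH ⇐ (D1) ∧ (D4) ∧ CAP+tail; G-an2-4 gates asym, D1 and NE2/3/4.»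

WHAT.  Road P2's T says the cell's `ℤ^{d+1}` typing of Bałaban's `U = 1` covariance ([Balaban1984PropagatorsII] (2.156) p. 250, TYPE locator only)
`C^{(k)}_Λ = C·(pad(CᵀΔ_kC))_Λ⁻¹·Cᵀ = covPad (elimZ L) (deltaZ L) (IsFreeZ L) Λ k` (elimination `C = elimZ L` of PART 11, (1.66) kernels `Δ_k = deltaZ L k`
of PART 8, free bonds `IsFreeZ L`) is `k`-uniformly decaying AND geometrically Cauchy (`θ = L⁻²`) on every `Λ ⊆ ℤ^{d+1}`.  Lineage gan24-p3 (gen 12,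
`GAN24/EffectiveLaplacianLimit`) NAMED the limit Laplacian `Δ_∞ = deltaZLim` and proved `|Δ_k − Δ_∞| ≤ theta166Z·(L⁻²)^k·e^{−kappaZ|·|}`.  PART 23
(`GAN24/DirichletExhaustionLimit`) is the abstract socket.  THIS FILE plugs Bałaban's typed objects into it:
* §1 `opLimitInput_balaban`: `OpLimitInput (deltaZ L) deltaZLim (c166Z d) (kappaZ d) (theta166Z d) L⁻²` — gan24-p3's three theorems BY NAME, in road
  P2's `OpClose` currency, with the SAME `(c₀, δ)` as PART 15's `covInputPad_balaban`;
* §2 [our object] **`perfectCovZ L Λ := covPadLim (elimZ L) deltaZLim (IsFreeZ L) Λ = C·(pad(CᵀΔ_∞C))_Λ⁻¹·Cᵀ`** — Bałaban's PERFECT (`k = ∞`) `U = 1`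
  covariance on the Dirichlet region `Λ ⊆ ℤ^{d+1}` in the cell's typing (it depends on `L` through the block elimination `C = elimZ L`, not through `Δ_∞`);
* §3 the inner limit operator `pad(CᵀΔ_∞C)`: it IS PART 2's `opLim` of the padded inner family (`opLim_innerPad_balaban`), satisfies (5.6) on `ℤ^{d+1}`
  with `(γ, c′, δ) = (gamma2153 (d+1) L, max{s·c166Z, 1}, kappaZ∕2)` — (2.157)-shape coercivity of the PERFECT quadratic form with Bałaban's `γ`
  (`hyp56Z_innerPad_balaban`) — and `C_Λ[pad(CᵀΔ_∞C)]` is its two-sided inverse on every `Λ` BY NAME (B4 Sect. 5 Theorem), UNIQUE among bounded left-inverse kernels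
  (`eq_limInv_innerPad_balaban_of_left_inverse`);
* §4 **`covPad_sub_perfectCovZ_abs_le`**: `|C^{(k)}_Λ(b,b′) − C^{(∞)}_Λ(b,b′)| ≤ R(d,L)·(L⁻²)^k·e^{−(δ⋆∕2)|b−b′|_∞}` for `d ≥ 1`, `L ≥ 2`, EVERY `Λ ⊆ ℤ^{d+1}`,
  every `k`, with `R(d,L) = limRateConst (d+1) (d+1) e^{kappaZ(L−1)} (c166Z d) (kappaZ d) (gamma2153 (d+1) L) (theta166Z d)` and
  `δ⋆ = limDeltaStar (d+1) (d+1) e^{kappaZ(L−1)} (c166Z d) (kappaZ d) (gamma2153 (d+1) L)` — DISPLAYED functions of `(d, L)` through PART 1's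
  `rateConst`, PART 3's `sandwichConst`, B4's `deltaStar`, t4-ne2's `C166`∕`MG`∕`kappa166` and b06∕pv09's `gamma2153`; `perfectCovZ_abs_le` (decay);
  **`tendsto_covPad_balaban`** (`C^{(k)}_Λ(b,b′) → C^{(∞)}_Λ(b,b′)`); §5 an2's `Decays` currency (`decays_toMKer_covPad_sub_perfectCovZ` = the hypothesis
  `h` of `Beta.HessKerDressedLimit.limMKerOf_eq_of_decays_rate`) and **`limMKerOf_covPad_eq_perfectCovZ`**: asym1's constructed limit
  `limMKerOf (k ↦ toMKer C^{(k)}_Λ)` IS `toMKer C^{(∞)}_Λ`.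
HONEST: names the `k = ∞` object of road P2's T and proves convergence to it with explicit constants; the S6 dictionary (`covPad` ↔ the wall's
`KInvStep`∕an2's `Gam` block) is NOT asserted; NO identification of `C^{(∞)}` with any continuum object is asserted; NOT the K-slot, NOT (hS, hSall),
NOT (hW, hWall), NOT (CONV-C) as a whole, NEVER «G-an2-4 closed»; NOT D1, NOT `BetaPertH`, NOT continuum, NOT Clay.

ABSOLUTE RULE (cell, verbatim): «No internally-minted statement may enter as a cited fact. Every hypothesis is either kernel-proved in this package or a
verbatim quotation of a PUBLISHED theorem with page reference. The manuscript(s) under audit are NOT citable for their own disputed steps — they are the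
thing under adjudication; programme-internal (2001/route/tribunal) claims are never citable.»  No hypothesis below is a printed statement; every input is
a tree theorem used BY NAME (`covInputPad_balaban`, `coer2157Z`, `deltaZLim_abs_le`, `deltaZLim_symm`, `deltaZ_sub_deltaZLim_abs_le`, PART 23); no
`def … : Prop` is minted.

## What this file proves (0 sorry; imports PARTS 23, 18 and gan24-p3's `EffectiveLaplacianLimit`)
`opLimitInput_balaban`; [our object] `perfectCovZ`, `perfectCovZ_eq`; `opLim_innerPad_balaban`, `hyp56Z_innerPad_balaban`, `tsum_innerPad_mul_limInv_balaban`,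
`tsum_limInv_mul_innerPad_balaban`, `eq_limInv_innerPad_balaban_of_left_inverse`; **`covPad_sub_perfectCovZ_abs_le`**, `perfectCovZ_abs_le`, **`tendsto_covPad_balaban`**, `perfectCovZ_symm`; `decays_toMKer_perfectCovZ`,
`decays_toMKer_covPad_sub_perfectCovZ`, **`limMKerOf_covPad_eq_perfectCovZ`**.  RECORDS TWIN: gan24-p3-g12's `GAN24/EffectiveCovarianceLimit` (p214518,
written in parallel, route «splice»; precedence ceded to PARTs 23∕24 in CLAIMS.log l.10547) has `covLim` ≡ `covPadLim` and `covZLim` ≡ `perfectCovZ` DEFINITIONALLY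
(`rfl`; not imported here — checked in `HOME/b2b-balaban-gan24-p2/gen16/xread/ProbeTwinRfl.lean`).  NOT summit progress.
-/

namespace Summit.QuantumFields.BalabanUV.Beta.GAN24.DirichletExhaustionPerfectCovariance

open Finset Real Filter Topology
open Literature.MathematicalPhysics.QuantumFieldTheory.Balaban1983to89
open Literature.MathematicalPhysics.QuantumFieldTheory.Balaban1983to89.Beta
open ExpKernelCalculus (MKer Decays)
open HessKerDressedLimit (limMKerOf limMKerOf_eq_of_decays_rate)
open B4Sect5Proof (cStar deltaStar cStar_pos deltaStar_pos)
open B4Sect5Exhaustion (K toMat Hyp56Z limInv)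
open B6Cov2156Torus (gamma2153 gamma2153_pos)
open T4Rate166StripDirect (thetaSq_nonneg thetaSq_lt_one)
open Summit.QuantumFields.BalabanUV.Beta.GAN24.DirichletExhaustion
open Summit.QuantumFields.BalabanUV.Beta.GAN24.DirichletExhaustionFamily
open Summit.QuantumFields.BalabanUV.Beta.GAN24.DirichletExhaustionSandwich
open Summit.QuantumFields.BalabanUV.Beta.GAN24.DirichletExhaustionCovariance
open Summit.QuantumFields.BalabanUV.Beta.GAN24.DirichletExhaustionCovariancePad
open Summit.QuantumFields.BalabanUV.Beta.GAN24.DirichletExhaustionDeltaZ (deltaZ c166Z theta166Z kappaZ kappaZ_pos)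
open Summit.QuantumFields.BalabanUV.Beta.GAN24.DirichletExhaustionElimZ (IsFreeZ elimZ)
open Summit.QuantumFields.BalabanUV.Beta.GAN24.DirichletExhaustionDecays (toMKer)
open Summit.QuantumFields.BalabanUV.Beta.GAN24.DirichletExhaustionAssembly (covInputPad_balaban theta166Z_nonneg)
open Summit.QuantumFields.BalabanUV.Beta.GAN24.DirichletExhaustionCoer (coer2157Z)
open Summit.QuantumFields.BalabanUV.Beta.GAN24.DirichletExhaustionLimit
open Summit.QuantumFields.BalabanUV.Beta.GAN24.EffectiveLaplacianLimit (deltaZLim deltaZLim_abs_le deltaZLim_symm deltaZ_sub_deltaZLim_abs_le)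

noncomputable section

variable {d : ℕ}

/-! ## §1 The named-limit input for Bałaban's (1.66) family -/

/-- **gan24-p3's three theorems in road P2's currency**: `OpLimitInput (deltaZ L) deltaZLim (c166Z d) (kappaZ d) (theta166Z d) L⁻²` for every `L ≥ 1`
(`deltaZLim_abs_le`, `deltaZLim_symm`, `deltaZ_sub_deltaZLim_abs_le` BY NAME). -/
theorem opLimitInput_balaban (L : ℕ) [NeZero L] :
    OpLimitInput (deltaZ (d := d) L) deltaZLim (c166Z d) (kappaZ d) (theta166Z d) (((L : ℝ) ^ 2)⁻¹) where
  bound := deltaZLim_abs_le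
  symm := deltaZLim_symm
  close k p q _ _ := by
    rw [abs_sub_comm]
    exact deltaZ_sub_deltaZLim_abs_le L k p q

/-! ## §2 The perfect covariance -/

/-- [our object] **BAŁABAN's PERFECT `U = 1` COVARIANCE ON THE DIRICHLET REGION `Λ ⊆ ℤ^{d+1}`** (cell typing):
`perfectCovZ L Λ = C·(pad(CᵀΔ_∞C))_Λ⁻¹·Cᵀ` with `C = elimZ L`, `Δ_∞ = deltaZLim`, free bonds `IsFreeZ L` — `covPad`'s formula at the named limit Laplacian. -/
def perfectCovZ (L : ℕ) (Λ : Set (Fin (d + 1) → ℤ)) : K (d + 1) (d + 1) → K (d + 1) (d + 1) → ℝ :=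
  covPadLim (elimZ L) deltaZLim (IsFreeZ L) Λ

/-- Unfolding lemma. -/
theorem perfectCovZ_eq (L : ℕ) (Λ : Set (Fin (d + 1) → ℤ)) :
    perfectCovZ L Λ = sandwich (trK (elimZ L)) (limInv Λ (padOp (IsFreeZ L) (sandwich (elimZ L) deltaZLim))) := rfl

/-! ## §3 The perfect inner operator `pad(CᵀΔ_∞C)` on `ℤ^{d+1}` -/

section Inner

/-- **PART 2's `opLim` of the padded inner family IS `pad(CᵀΔ_∞C)`** for Bałaban's objects (`d ≥ 1`, `L ≥ 2`). -/
theorem opLim_innerPad_balaban (hd : 1 ≤ d) (L : ℕ) [NeZero L] (hL : 2 ≤ L) :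
    opLim (fun k => padOp (IsFreeZ L) (sandwich (elimZ L) (deltaZ (d := d) L k))) =
      padOp (IsFreeZ L) (sandwich (elimZ L) deltaZLim) :=
  opLim_innerPad_eq (covInputPad_balaban L (coer2157Z hd L)) (opLimitInput_balaban L) (kappaZ_pos d) (Real.exp_pos _).le
    (theta166Z_nonneg d) (thetaSq_nonneg L) (thetaSq_lt_one hL)

/-- **THE PERFECT INNER OPERATOR SATISFIES (5.6) ON `ℤ^{d+1}` WITH BAŁABAN's `γ`**: `Hyp56Z ℤ^{d+1} (pad(CᵀΔ_∞C)) (gamma2153 (d+1) L) (max{s·c166Z, 1}) (kappaZ∕2)`,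
`s = sandwichConst (d+1) (d+1) e^{kappaZ(L−1)} kappaZ` — in particular the (2.157)-SHAPE COERCIVITY `γ‖v‖² ≤ ⟨v, (pad(CᵀΔ_∞C))_Λ v⟩` on every finite `Λ`
for the PERFECT quadratic form (PART 18's `coer2157Z` passed to the limit). -/
theorem hyp56Z_innerPad_balaban (hd : 1 ≤ d) (L : ℕ) [NeZero L] (hL : 2 ≤ L) :
    Hyp56Z (Set.univ : Set (Fin (d + 1) → ℤ)) (padOp (IsFreeZ L) (sandwich (elimZ L) (deltaZLim (d := d)))) (gamma2153 (d + 1) L)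
      (max (sandwichConst (d + 1) (d + 1) (Real.exp (kappaZ d * ((L : ℝ) - 1))) (kappaZ d) * c166Z d) 1) (kappaZ d / 2) :=
  hyp56Z_innerPadLim (covInputPad_balaban L (coer2157Z hd L)) (opLimitInput_balaban L) (kappaZ_pos d) (Real.exp_pos _).le
    (theta166Z_nonneg d) (theta166Z_nonneg d) (thetaSq_nonneg L) (thetaSq_lt_one hL)

/-- `C_Λ[pad(CᵀΔ_∞C)]` is a RIGHT inverse of `(pad(CᵀΔ_∞C))_Λ` on every `Λ ⊆ ℤ^{d+1}`: `Σ_q pad(CᵀΔ_∞C)(p,q)·C_Λ[…](q,r) = δ_{pr}`, `p, r ∈ Λ`. -/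
theorem tsum_innerPad_mul_limInv_balaban (hd : 1 ≤ d) (L : ℕ) [NeZero L] (hL : 2 ≤ L) (Λ : Set (Fin (d + 1) → ℤ))
    {p r : K (d + 1) (d + 1)} (hp : p.1 ∈ Λ) (hr : r.1 ∈ Λ) :
    ∑' q, padOp (IsFreeZ L) (sandwich (elimZ L) (deltaZLim (d := d))) p q *
        limInv Λ (padOp (IsFreeZ L) (sandwich (elimZ L) deltaZLim)) q r = if p = r then 1 else 0 :=
  tsum_innerPadLim_mul_limInv (covInputPad_balaban L (coer2157Z hd L)) (opLimitInput_balaban L) (kappaZ_pos d) (Real.exp_pos _).le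
    (gamma2153_pos (by omega) (Nat.pos_of_ne_zero (NeZero.ne L))) (theta166Z_nonneg d) (theta166Z_nonneg d) (thetaSq_nonneg L)
    (thetaSq_lt_one hL) (Set.subset_univ Λ) hp hr

/-- … and a LEFT inverse: `Σ_q C_Λ[pad(CᵀΔ_∞C)](p,q)·pad(CᵀΔ_∞C)(q,r) = δ_{pr}`, `p, r ∈ Λ`. -/
theorem tsum_limInv_mul_innerPad_balaban (hd : 1 ≤ d) (L : ℕ) [NeZero L] (hL : 2 ≤ L) (Λ : Set (Fin (d + 1) → ℤ))
    {p r : K (d + 1) (d + 1)} (hp : p.1 ∈ Λ) (hr : r.1 ∈ Λ) :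
    ∑' q, limInv Λ (padOp (IsFreeZ L) (sandwich (elimZ L) (deltaZLim (d := d)))) p q *
        padOp (IsFreeZ L) (sandwich (elimZ L) deltaZLim) q r = if p = r then 1 else 0 :=
  tsum_limInv_mul_innerPadLim (covInputPad_balaban L (coer2157Z hd L)) (opLimitInput_balaban L) (kappaZ_pos d) (Real.exp_pos _).le
    (gamma2153_pos (by omega) (Nat.pos_of_ne_zero (NeZero.ne L))) (theta166Z_nonneg d) (theta166Z_nonneg d) (thetaSq_nonneg L)
    (thetaSq_lt_one hL) (Set.subset_univ Λ) hp hr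

/-- **UNIQUENESS OF THE PERFECT INNER INVERSE** (`d ≥ 1`, `L ≥ 2`): any entrywise-bounded left-inverse kernel of `(pad(CᵀΔ_∞C))_Λ` vanishing off `Λ` in its second
index IS `C_Λ[pad(CᵀΔ_∞C)]` on `Λ × Λ` (B4's Sect. 5 uniqueness `B4Sect5Exhaustion.eq_limInv_of_left_inverse` BY NAME via `hyp56Z_innerPad_balaban`;
abstract twin: PART 23 v1.1 `eq_limInv_innerPadLim_of_left_inverse`) — the inner kernel of `perfectCovZ` is
forced by `Δ_∞`, not a choice of exhaustion or of the approximating scale family. -/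
theorem eq_limInv_innerPad_balaban_of_left_inverse (hd : 1 ≤ d) (L : ℕ) [NeZero L] (hL : 2 ≤ L) (Λ : Set (Fin (d + 1) → ℤ))
    {D : K (d + 1) (d + 1) → K (d + 1) (d + 1) → ℝ} {M : ℝ} (hDM : ∀ p q, |D p q| ≤ M)
    (hD0 : ∀ p q : K (d + 1) (d + 1), q.1 ∉ Λ → D p q = 0)
    (hDA : ∀ p r : K (d + 1) (d + 1), p.1 ∈ Λ → r.1 ∈ Λ →
      ∑' q, D p q * padOp (IsFreeZ L) (sandwich (elimZ L) (deltaZLim (d := d))) q r = if p = r then 1 else 0)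
    {p s : K (d + 1) (d + 1)} (hp : p.1 ∈ Λ) (hs : s.1 ∈ Λ) :
    D p s = limInv Λ (padOp (IsFreeZ L) (sandwich (elimZ L) deltaZLim)) p s :=
  B4Sect5Exhaustion.eq_limInv_of_left_inverse (gamma2153_pos (by omega) (Nat.pos_of_ne_zero (NeZero.ne L)))
    (lt_max_of_lt_right one_pos) (half_pos (kappaZ_pos d)) ((hyp56Z_innerPad_balaban hd L hL).mono (Set.subset_univ Λ))
    hDM hD0 hDA hp hs

end Inner

/-! ## §4 The rate `C^{(k)}_Λ → C^{(∞)}_Λ`, the decay of `C^{(∞)}_Λ`, the entrywise limit -/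

section Rate

/-- **`covPad_sub_perfectCovZ_abs_le` — THE RATE TO THE PERFECT COVARIANCE, CONSTANTS EXPLICIT IN `(d, L)`** (`d ≥ 1`, `L ≥ 2`): on EVERY `Λ ⊆ ℤ^{d+1}`,
every `k`, all bonds `b = (x,α)`, `b′ = (y,β)`:
`|C^{(k)}_Λ(b,b′) − C^{(∞)}_Λ(b,b′)| ≤ limRateConst (d+1) (d+1) e^{κ(L−1)} c166Z κ γ θ166Z · (L⁻²)^k · e^{−(δ⋆∕2)|x−y|_∞}`,
`κ = kappaZ d`, `γ = gamma2153 (d+1) L`, `δ⋆ = limDeltaStar (d+1) (d+1) e^{κ(L−1)} c166Z κ γ`. -/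
theorem covPad_sub_perfectCovZ_abs_le (hd : 1 ≤ d) (L : ℕ) [NeZero L] (hL : 2 ≤ L) (Λ : Set (Fin (d + 1) → ℤ)) (k : ℕ)
    (p q : K (d + 1) (d + 1)) :
    |covPad (elimZ L) (deltaZ L) (IsFreeZ L) Λ k p q - perfectCovZ L Λ p q| ≤
      limRateConst (d + 1) (d + 1) (Real.exp (kappaZ d * ((L : ℝ) - 1))) (c166Z d) (kappaZ d) (gamma2153 (d + 1) L) (theta166Z d) *
        (((L : ℝ) ^ 2)⁻¹) ^ k *
        Real.exp (-(limDeltaStar (d + 1) (d + 1) (Real.exp (kappaZ d * ((L : ℝ) - 1))) (c166Z d) (kappaZ d) (gamma2153 (d + 1) L) / 2 *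
          dist p.1 q.1)) :=
  covPad_sub_covPadLim_abs_le (covInputPad_balaban L (coer2157Z hd L)) (opLimitInput_balaban L) (kappaZ_pos d) (Real.exp_pos _).le
    (gamma2153_pos (by omega) (Nat.pos_of_ne_zero (NeZero.ne L))) (theta166Z_nonneg d) (theta166Z_nonneg d) (thetaSq_nonneg L)
    (thetaSq_lt_one hL) (Set.subset_univ Λ) k p q

/-- **DECAY OF THE PERFECT COVARIANCE** (`d ≥ 1`, `L ≥ 2`): `|C^{(∞)}_Λ(b,b′)| ≤ limDecayConst (d+1) (d+1) e^{κ(L−1)} c166Z κ γ · e^{−(δ⋆∕2)|x−y|_∞}` on every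
`Λ ⊆ ℤ^{d+1}`. -/
theorem perfectCovZ_abs_le (hd : 1 ≤ d) (L : ℕ) [NeZero L] (hL : 2 ≤ L) (Λ : Set (Fin (d + 1) → ℤ)) (p q : K (d + 1) (d + 1)) :
    |perfectCovZ L Λ p q| ≤
      limDecayConst (d + 1) (d + 1) (Real.exp (kappaZ d * ((L : ℝ) - 1))) (c166Z d) (kappaZ d) (gamma2153 (d + 1) L) *
        Real.exp (-(limDeltaStar (d + 1) (d + 1) (Real.exp (kappaZ d * ((L : ℝ) - 1))) (c166Z d) (kappaZ d) (gamma2153 (d + 1) L) / 2 *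
          dist p.1 q.1)) :=
  covPadLim_abs_le (covInputPad_balaban L (coer2157Z hd L)) (opLimitInput_balaban L) (kappaZ_pos d) (Real.exp_pos _).le
    (gamma2153_pos (by omega) (Nat.pos_of_ne_zero (NeZero.ne L))) (theta166Z_nonneg d) (theta166Z_nonneg d) (thetaSq_nonneg L)
    (thetaSq_lt_one hL) (Set.subset_univ Λ) p q

/-- **`tendsto_covPad_balaban` — THE PERFECT COVARIANCE IS THE LIMIT** (`d ≥ 1`, `L ≥ 2`): `C^{(k)}_Λ(b,b′) → C^{(∞)}_Λ(b,b′)` for every `Λ ⊆ ℤ^{d+1}` and all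
bonds — the `k = ∞` companion of road P2's Cauchy-form T `DirichletExhaustionCoer.convC_balaban`. -/
theorem tendsto_covPad_balaban (hd : 1 ≤ d) (L : ℕ) [NeZero L] (hL : 2 ≤ L) (Λ : Set (Fin (d + 1) → ℤ)) (p q : K (d + 1) (d + 1)) :
    Tendsto (fun k => covPad (elimZ L) (deltaZ L) (IsFreeZ L) Λ k p q) atTop (𝓝 (perfectCovZ L Λ p q)) :=
  tendsto_covPad (covInputPad_balaban L (coer2157Z hd L)) (opLimitInput_balaban L) (kappaZ_pos d) (Real.exp_pos _).le
    (gamma2153_pos (by omega) (Nat.pos_of_ne_zero (NeZero.ne L))) (theta166Z_nonneg d) (theta166Z_nonneg d) (thetaSq_nonneg L)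
    (thetaSq_lt_one hL) (Set.subset_univ Λ) p q

/-- **THE PERFECT COVARIANCE IS A SYMMETRIC KERNEL** (`d ≥ 1`, `L ≥ 2`): `C^{(∞)}_Λ(b,b′) = C^{(∞)}_Λ(b′,b)` (B4's `limInv_symm` for the (5.6) operator `pad(CᵀΔ_∞C)`
restricted to `Λ`, then PART 3's `sandwich_symm` for the outer `C·(·)·Cᵀ`). -/
theorem perfectCovZ_symm (hd : 1 ≤ d) (L : ℕ) [NeZero L] (hL : 2 ≤ L) (Λ : Set (Fin (d + 1) → ℤ)) (p q : K (d + 1) (d + 1)) :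
    perfectCovZ L Λ p q = perfectCovZ L Λ q p :=
  sandwich_symm (fun r s => B4Sect5Exhaustion.limInv_symm (gamma2153_pos (by omega) (Nat.pos_of_ne_zero (NeZero.ne L)))
    (lt_max_of_lt_right one_pos) (half_pos (kappaZ_pos d)) ((hyp56Z_innerPad_balaban hd L hL).mono (Set.subset_univ Λ)) r s) p q

end Rate

/-! ## §5 an2's `Decays` currency -/

section Currency

/-- `Decays (toMKer C^{(∞)}_Λ) (limDecayConst …) (δ⋆∕(2(d+1)))`. -/
theorem decays_toMKer_perfectCovZ (hd : 1 ≤ d) (L : ℕ) [NeZero L] (hL : 2 ≤ L) (Λ : Set (Fin (d + 1) → ℤ)) :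
    Decays (toMKer (perfectCovZ L Λ))
      (limDecayConst (d + 1) (d + 1) (Real.exp (kappaZ d * ((L : ℝ) - 1))) (c166Z d) (kappaZ d) (gamma2153 (d + 1) L))
      (limDeltaStar (d + 1) (d + 1) (Real.exp (kappaZ d * ((L : ℝ) - 1))) (c166Z d) (kappaZ d) (gamma2153 (d + 1) L) / 2 /
        ((d + 1 : ℕ) : ℝ)) :=
  decays_toMKer_covPadLim (covInputPad_balaban L (coer2157Z hd L)) (opLimitInput_balaban L) (kappaZ_pos d) (Real.exp_pos _).le
    (gamma2153_pos (by omega) (Nat.pos_of_ne_zero (NeZero.ne L))) (theta166Z_nonneg d) (theta166Z_nonneg d) (thetaSq_nonneg L)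
    (thetaSq_lt_one hL) (Set.subset_univ Λ)

/-- **THE RATE IN `Decays` CURRENCY**: `Decays (toMKer C^{(k)}_Λ − toMKer C^{(∞)}_Λ) (limRateConst … · (L⁻²)^k) (δ⋆∕(2(d+1)))` for every `k` — LITERALLY the
hypothesis `h : ∀ k, Decays (K k − Kinf) (c * θ ^ k) δ` of `Beta.HessKerDressedLimit.limMKerOf_eq_of_decays_rate` ∕ `tendsto_of_decays_rate` at
`K := fun k => toMKer (covPad (elimZ L) (deltaZ L) (IsFreeZ L) Λ k)`, `Kinf := toMKer (perfectCovZ L Λ)`, `θ := L⁻²`. -/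
theorem decays_toMKer_covPad_sub_perfectCovZ (hd : 1 ≤ d) (L : ℕ) [NeZero L] (hL : 2 ≤ L) (Λ : Set (Fin (d + 1) → ℤ)) (k : ℕ) :
    Decays (toMKer (covPad (elimZ L) (deltaZ L) (IsFreeZ L) Λ k) - toMKer (perfectCovZ L Λ))
      (limRateConst (d + 1) (d + 1) (Real.exp (kappaZ d * ((L : ℝ) - 1))) (c166Z d) (kappaZ d) (gamma2153 (d + 1) L) (theta166Z d) *
        (((L : ℝ) ^ 2)⁻¹) ^ k)
      (limDeltaStar (d + 1) (d + 1) (Real.exp (kappaZ d * ((L : ℝ) - 1))) (c166Z d) (kappaZ d) (gamma2153 (d + 1) L) / 2 /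
        ((d + 1 : ℕ) : ℝ)) :=
  decays_toMKer_covPad_sub_covPadLim (covInputPad_balaban L (coer2157Z hd L)) (opLimitInput_balaban L) (kappaZ_pos d)
    (Real.exp_pos _).le (gamma2153_pos (by omega) (Nat.pos_of_ne_zero (NeZero.ne L))) (theta166Z_nonneg d) (theta166Z_nonneg d)
    (thetaSq_nonneg L) (thetaSq_lt_one hL) (Set.subset_univ Λ) k

/-- **asym1's CONSTRUCTED LIMIT OF THE COVARIANCE CONSTITUENT IS THE PERFECT COVARIANCE** (`d ≥ 1`, `L ≥ 2`):
`limMKerOf (k ↦ toMKer C^{(k)}_Λ) = toMKer C^{(∞)}_Λ` — ONE application of `Beta.HessKerDressedLimit.limMKerOf_eq_of_decays_rate` (already in road P2's import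
cone through PART 6 ∕ gan24-p1's `GAN24/CombesThomas`) to `decays_toMKer_covPad_sub_perfectCovZ`. -/
theorem limMKerOf_covPad_eq_perfectCovZ (hd : 1 ≤ d) (L : ℕ) [NeZero L] (hL : 2 ≤ L) (Λ : Set (Fin (d + 1) → ℤ)) :
    limMKerOf (fun k => toMKer (covPad (elimZ L) (deltaZ L) (IsFreeZ L) Λ k)) = toMKer (perfectCovZ L Λ) :=
  limMKerOf_eq_of_decays_rate (decays_toMKer_covPad_sub_perfectCovZ hd L hL Λ) (thetaSq_nonneg L) (thetaSq_lt_one hL)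

end Currency

end

end Summit.QuantumFields.BalabanUV.Beta.GAN24.DirichletExhaustionPerfectCovariance
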